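import Summits.QuantumFields.YangMills.Theorems.BalabanUVNodesN07RecordCubeTowerWindow
import Literature.MathematicalPhysics.QuantumFieldTheory.Balaban1983to89.B8ExpMeanLogCrossTermFamilyRec
import Literature.MathematicalPhysics.QuantumFieldTheory.Balaban1983to89.B8ExpMeanLogCrossTermRightConstRec
import Literature.MathematicalPhysics.QuantumFieldTheory.Balaban1983to89.Node00.TorusCoverGaugeAveragesZdPhi
import HarnessLib

/-!
# N07 [B11] (= [15] = [Balaban1985Variational]) Sect. F ∕ [6] Prop. 6, (1.29) ∕ [3] (78)–(81), (167) ∕ [I] (0.3)–(0.4) — **THE JUNCTION's TORUS ROW 9′ AT A CELL OF A DENTED RECORD CUBE,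
# ASSEMBLED BY NAME**: glue identity → locality → cell bound + product family rows → guard release ⇒ `‖R̄^{j′}(g₁·u′⁻¹)(π_{j′}(y + c_{k−j′}·𝟙)) − 1‖ ≤ 1024·(4(ω_τ + ω_u))²`

Cell `pub-ymgap`, width seat `pub-ymgap-dag-n07-w3` g13 (junction side of the K0 road; the per-cell step of the knit, JUNCTION-PHI-ROAD §12).  `--kind proof --supports stmt-QuantumFields-20541
--as helper` (K0⁷; count-neutral; ONE theorem, 0 `def`).  [I] = [Balaban1987RG1]; [3] = [Balaban1985Averaging]; [6] = [Balaban1985RegularSpaces]; [15] = [Balaban1985Variational].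
CONSUMED BY NAME: this seat's ✓p759262 `…N07RecordCubeTowerWindow.{norm_uavgZ_one_lift_mul_inv_mul_sub_one_le_at_recordCube_cell, hpt_lift_at_recordCube_cell,
lift_mul_inv_eq_tau_mul_hinv_mul_of_door}`, ✓p759793 `B8ExpMeanLogCrossTermFamilyRec.osc_row_mul_under`, ✓p752835 `B8ExpMeanLogCrossTermRightConstRec.osc_row_mul_const_eq`, ✓p753816
`B8ExpMeanLogOscFromPointwiseRec.{osc_rows_of_pointwise_under, uavgZ_one_unitary_and_near_centre_under}`, ✓p757118 `…N07TowerOscCoverBridge.lift_mem_unitaryUnits_under`, FILE 40c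
✓p747382∕✓p759539 `Node00.TorusCoverGaugeAveragesZdPhi.{norm_coe_gaugeAvgIter_sub_one_le_of_rbar_under, rbar_bgTZ_one_apply, uavgZ_one_congr_under, uavgZ_one_congr_at, underZ_smul_add_offZ}`,
dag-n05-e ✓p748893 `B8BlockConstantLiftDentedRec.mem_sq_zero_of_underZ_lamS`.

WHY.  Row 9′ of the def of record (`NrmSymPhiOfRecord … (Ψ ε j)`) reads, at every (1.29)-cell of the domains-meet tower, the GUARDED torus average `R̄^{j′}` of the torus function `h̄·w·u′⁻¹ =
g₁·u′⁻¹` (`g₁` the sym carrier with its block-constant top gauge, `u′` the glued Theorem-4 gauge of the door).  THIS FILE is that row AT ONE CELL `y ∈ c.lamS j′` of a dented record cube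
`c`, from displayed data only: (i) the door's member identity `ιSU(u′(π(x + c_k·𝟙))) = ((h⁻¹·u₀) x)⁻¹·vfix x` on `Ω′₀` (dag-n07-e's explicit-`u` door ✓`…_precomp_explicit`) and `vfix = lift g₂` there
(g12 `…N07TowerGaugeCoverLiftWindow`) ⇒ the lift of `g₁·u′⁻¹` IS `τ·h⁻¹·u₀` on `Ω′₀ ⊇` the cell's tower (✓p759262 §5, ✓p748893); (ii) locality (FILE 40c v1.3) ⇒ its record averages under
the cell are those of `τ·h⁻¹·u₀`; (iii) the cell bound `‖R̄₀^{j′}(τ·h⁻¹·u₀)(y) − 1‖ ≤ 1024·(4(ω_τ + ω_u))²` (✓p759262 §4: collar inclusion, one fine letter, two axialities, numerics, (σ1) letters);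
(iv) the product's (78) families under the cell (✓p759793 with `a := τ·h⁻¹` — rows of `τ` by ✓p753816 on ✓p759262's `hpt`, unchanged by the block constant `h⁻¹` under the cell, ✓p752835 —
and `u := u₀`) are `< δ_N` given the displayed guard numerics; (v) FILE 40c's guard release + φ-row dictionary ⇒ the torus row.  Pure composition: NO estimate of [I]∕[3]∕[6]∕[15] asserted.

WHAT IS PROVED (sorry-free).  ★★★ `torusRow_at_recordCube_cell` — hypotheses: those of ✓p759262 §4 (`c`, `hk`, `U`, `g₁`, `g₂`, `hax₁`, `hax₂`, `hN`, one fine letter on `plaqsOf Ω_c`, `hcollar`,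
numerics `a`∕`hbud`∕`hgd`∕`haa`∕`h100`∕`hguard`∕`hE`, `θ ≤ 1∕8`, `ω_τ + ω_u ≤ 1∕512`, `4096θ(ω_τ+ω_u) ≤ 1`, `hjk`, `hy`, `h`, `u₀` with `hu`, `hh`, `hptu`, `hu1`) + the door identity `hsid`
(explicit `um := h⁻¹·u₀`), `hvfix`, and the guard numerics `hguardN`; conclusion: `‖(R̄^{j′}(g₁·u′⁻¹))(π_{j′}(y + c_{k−j′}·𝟙)) − 1‖ ≤ 1024·(4(ω_τ + ω_u))²` for the GUARDED torus average
`gaugeAvgIter (loopAvgBlockOp expMeanLogSU)` — the shape ✓p748195 `nrmSymPhiOfRecord_of_coverRow` pushes down to `NrmSymPhiOfRecord`.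
HONEST FRAMING: count-neutral helper; composition of landed names — nothing of [I]∕[3]∕[6]∕[15] asserted or discharged; all analytic inputs (fine letter, axialities, (σ1) letters, door identity,
collar inclusion, numerics) remain DISPLAYED hypotheses; `NrmSymPhiOfRecord` ∕ `HThm4RecSym152PhiE(G)` ∕ `HThm4Rec*` UNDISCHARGED; N05 ∕ N07 NOT discharged; K0⁷ ∕ K1⁹ NOT closed; counts unmoved
(typed 28∕28 · discharged 8∕28); one finite 𝕋⁴ programme at fixed ε — R4 closes the conditional finite-𝕋⁴ rung `BalabanLadder.UV` only; the YM mass gap (Clay) is NOT proved by any of this;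
nothing continuum ∕ ℝ⁴ ∕ OS.  No `def`, no `instance`, no `notation`, no `sorry`.

References: [I] (0.1) p. 251, (0.3)–(0.4) pp. 252–253, (0.11) p. 253; [3] (78)–(81) p. 30, (167) p. 44; [6] Prop. 6 (1.130)–(1.138) p. 99, (1.29) p. 81, p. 98; [15] (147)–(154) pp. 301–302.
-/

set_option autoImplicit false

noncomputable section

open scoped BigOperators Matrix.Norms.L2Operator

namespace Summit.QuantumFields.YangMills.BalabanUVNodes.N07SymPhiTorusRowAtRecordCubeCell

open Literature.MathematicalPhysics.QuantumFieldTheory.Balaban1983to89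
open Literature.MathematicalPhysics.QuantumFieldTheory.Balaban1983to89.Node00
open T4Continuum (T4Family)
open B14DomainGeom (Pt)
open GaugeField (gaugeAct)
open ExpMeanLog (expMeanLogSU deltaSU)
open BlockAveragingZd (ctrShift offZ)
open B7Eq78Linearization (Rbar)
open B8Eq119TwistedAxialRec (UnderZ underZ_zero_iff underZ_one_centre)
open B8BlockConstantLiftStabilityRec (underZ_add)
open B8BlockConstantLiftDentedRec (mem_sq_zero_of_underZ_lamS)
open B15Eq112TorusCover (cover)
open B7Prop1Explicit (U1)
open B7Prop2Explicit (unitaryUnits unitaryUnits_le_U1)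
open B7SectCDGaugeAveragesRec (uavgZ)
open B7SectEFLinearisationRec (zdBlockingZ bgTZ blockSitesZ mem_blockSitesZ)
open B8Eq17ClassAkV1 (plaqsOf)
open B8Eq131Cubes (tcube)
open B8ExpMeanLogOscFromPointwiseRec (osc_rows_of_pointwise_under uavgZ_one_unitary_and_near_centre_under)
open B8ExpMeanLogCrossTermRightConstRec (osc_row_mul_const_eq)
open B8ExpMeanLogCrossTermFamilyRec (osc_row_mul_under)
open Summit.QuantumFields.Balaban3D.Carriers (radialContourData)
open Summit.QuantumFields.YangMills.BalabanUVNodes.N07NormalisationSymOfRecord (symCd)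
open Summit.QuantumFields.YangMills.BalabanUVNodes.N07TowerOscCoverBridge (lift_mem_unitaryUnits_under)
open Summit.QuantumFields.YangMills.BalabanUVNodes.N07RecordCubeTowerWindow (norm_uavgZ_one_lift_mul_inv_mul_sub_one_le_at_recordCube_cell hpt_lift_at_recordCube_cell
  lift_mul_inv_eq_tau_mul_hinv_mul_of_door)

variable {F : T4Family} (N : ℕ) [NeZero N]

/-- ★★★ **THE TORUS ROW 9′ AT A CELL OF A DENTED RECORD CUBE, BY NAME** — see the module docstring: glue identity → locality → cell bound + product family rows → guard release.
[cite: Balaban1985RegularSpaces, Prop. 6 (1.130)–(1.138) p.99, (1.29) p.81, p.98; Balaban1985Averaging, (78)–(81) p.30, (167) p.44; Balaban1987RG1, (0.3)–(0.4) pp.252–253, (0.11) p.253; Balaban1985Variational, (147)–(154) pp.301–302] -/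
theorem torusRow_at_recordCube_cell {K K' : ℕ} {Ω' : ℕ → Set (B7Prop1Explicit.Site (F.P K).d)} (c : CubeB8DZ (F.P K).d (F.P K).L K' Ω')
    (hk : c.k ≤ (F.P K).m + (F.P K).K) (U : GaugeField (F.P K) 0 (SU N))
    (g₁ g₂ : GaugeTransf (F.P K) 0 (SU N))
    (hax₁ : ∀ n, n < c.k → AxialGauge (symCd F N K n) (Averaging.iter (avOfRecord F N K) n (gaugeAct g₁ U)))
    (hax₂ : ∀ n, n < c.k → AxialGauge (radialContourData (F.P K) n (SU N)) (Averaging.iter (avOfRecord F N K) n (gaugeAct g₂ U)))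
    (hN : ∀ n, n < c.k → (F.P K).L < (F.P K).sitesPerDir n)
    {a₀ : ℝ} (ha₀ : 0 ≤ a₀) {Ωc : Set (Site (F.P K) 0)} (hU : PlaqSmallOn (plaqsOf Ωc) a₀ U)
    (hcollar : cover (F.P K) '' tcube (F.P K).L c.a c.M c.ρ c.k ⊆ Ωc)
    (a : ℕ → ℝ) (ha : ∀ n, 0 ≤ a n)
    (hbud : ∀ n, n < c.k →
      6400 * ((((F.P K).d + 2) * (F.P K).L : ℕ) : ℝ) ^ 2 * ((F.P K).L : ℝ) ^ (n + 1) * (((((F.P K).d - 1 : ℕ) : ℝ)) * ((((F.P K).L ^ (n + 1) - 1 : ℕ) : ℝ)) * a₀) ≤ 1)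
    (hgd : ∀ n, n < c.k →
      30 * ((((F.P K).d + 2) * (F.P K).L : ℕ) : ℝ) ^ 2 * ((F.P K).L : ℝ) ^ (n + 1) * (((((F.P K).d - 1 : ℕ) : ℝ)) * ((((F.P K).L ^ (n + 1) - 1 : ℕ) : ℝ)) * a₀) < deltaSU (Fin N))
    (haa : ∀ n, n < c.k →
      120 * ((((F.P K).d + 2) * (F.P K).L : ℕ) : ℝ) * ((F.P K).L : ℝ) ^ n * (((((F.P K).d - 1 : ℕ) : ℝ)) * ((((F.P K).L ^ (n + 1) - 1 : ℕ) : ℝ)) * a₀) < a n)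
    (h100 : ∀ n, n < c.k → 2 * ((((F.P K).d * (((F.P K).L - 1) / 2) : ℕ) : ℝ) * (((((F.P K).d - 1 : ℕ) : ℝ) * (((F.P K).L - 1 : ℕ) : ℝ)) * a n)) ≤ 1 / 100)
    (hguard : ∀ n, n < c.k →
      2 * ((((F.P K).d * (((F.P K).L - 1) / 2) : ℕ) : ℝ) * (((((F.P K).d - 1 : ℕ) : ℝ) * (((F.P K).L - 1 : ℕ) : ℝ)) * a n)) < (FederbushMean.federbushSU (n := Fin N)).δ)
    {ωτ ωu θ : ℝ} (hθ0 : 0 ≤ θ) (hθ : θ ≤ 1 / 8) (hωτ0 : 0 ≤ ωτ) (hωu0 : 0 ≤ ωu) (hω : ωτ + ωu ≤ 1 / 512) (hθω : 4096 * θ * (ωτ + ωu) ≤ 1)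
    (hE : ∀ m, m < c.k → 4 * (2 * ((((F.P K).d * (((F.P K).L - 1) / 2) : ℕ) : ℝ) * (((((F.P K).d - 1 : ℕ) : ℝ) * (((F.P K).L - 1 : ℕ) : ℝ)) * a m))) ≤
      ωτ / 2 * θ ^ (c.k - (m + 1)))
    {j : ℕ} (hjk : j ≤ c.k) {y : Pt (F.P K).d} (hy : y ∈ c.lamS j)
    (h u : Pt (F.P K).d → (MatA N)ˣ)
    (hu : letI : CStarAlgebra (MatA N) := {}; ∀ x, UnderZ (F.P K).L j y x → u x ∈ unitaryUnits (MatA N))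
    (hh : ∀ x, UnderZ (F.P K).L j y x →
      h x = uavgZ (F.P K).L (1 : Pt (F.P K).d → Fin (F.P K).d → (MatA N)ˣ)
        (fun x => ιSU N ((fun x' => g₁ x' * (g₂ x')⁻¹) (cover (F.P K) (x + fun _ => ((ctrShift (F.P K).L c.k : ℕ) : ℤ))))) j y)
    (hptu : ∀ i, i < j → ∀ z, UnderZ (F.P K).L (j - (i + 1)) y z → ∀ w, UnderZ (F.P K).L (i + 1) z w →
      ‖((((u ((((F.P K).L : ℤ) ^ (i + 1)) • z))⁻¹ * u w : (MatA N)ˣ)) : MatA N) - 1‖ ≤ ωu * θ ^ (j - (i + 1)))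
    (hu1 : uavgZ (F.P K).L (1 : Pt (F.P K).d → Fin (F.P K).d → (MatA N)ˣ) u j y = 1)
    -- the door's member identity (n07-e ✓131 `…_precomp_explicit` at `um := h⁻¹·u`), the crown's radial gauge as the lift of `g₂` (g12 `localGaugeZ_coverLiftShift_eq_of_mem_tcubeZ`)
    (u' : GaugeTransf (F.P K) 0 (SU N)) (vfixV : Pt (F.P K).d → (MatA N)ˣ)
    (hsid : ∀ x ∈ c.sq 0, ιSU N (u' (cover (F.P K) (x + fun _ => ((ctrShift (F.P K).L c.k : ℕ) : ℤ)))) = ((h⁻¹ * u) x)⁻¹ * vfixV x)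
    (hvfix : ∀ x ∈ c.sq 0, vfixV x = ιSU N (g₂ (cover (F.P K) (x + fun _ => ((ctrShift (F.P K).L c.k : ℕ) : ℤ)))))
    -- the guard numerics ([I] (0.4): the product's (78) families under the cell stay below `δ_N`)
    (hguardN : ∀ i, i < j → 4 * ωτ * θ ^ (j - (i + 1)) + 4 * ωu * θ ^ (j - (i + 1)) + 2 * (1024 * (4 * (ωτ + ωu) * θ ^ (j - i)) ^ 2) < deltaSU (Fin N)) :
    ‖((gaugeAvgIter (loopAvgBlockOp expMeanLogSU) (fun x => g₁ x * (u' x)⁻¹) j (coverAt (F.P K) j (y + fun _ => ((ctrShift (F.P K).L (c.k - j) : ℕ) : ℤ))) : SU N) :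
        Matrix (Fin N) (Fin N) ℂ) - 1‖ ≤ 1024 * (4 * (ωτ + ωu)) ^ 2 := by
  letI : CStarAlgebra (MatA N) := {}
  have hL := (F.P K).hL.1
  have hθ2 : θ ≤ 1 / 2 := hθ.trans (by norm_num)
  have hωτ128 : ωτ ≤ 1 / 128 := by linarith
  have hωu128 : ωu ≤ 1 / 128 := by linarith
  set τZ : Pt (F.P K).d → (MatA N)ˣ := (fun x => ιSU N ((fun x' => g₁ x' * (g₂ x')⁻¹) (cover (F.P K) (x + fun _ => ((ctrShift (F.P K).L c.k : ℕ) : ℤ))))) with hτZ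
  set gZ : Pt (F.P K).d → (MatA N)ˣ := (fun x => ιSU N ((fun x' => g₁ x' * (u' x')⁻¹) (cover (F.P K) (x + fun _ => ((ctrShift (F.P K).L c.k : ℕ) : ℤ))))) with hgZ
  -- (0) the cell's tower lies in `Ω′₀ = c.sq 0`
  have hsq : ∀ x, UnderZ (F.P K).L j y x → x ∈ c.sq 0 := fun x hx => mem_sq_zero_of_underZ_lamS hL c hjk hy hx
  -- (1) the glue identity under the cell
  have hglue : ∀ x, UnderZ (F.P K).L j y x → gZ x = (τZ * h⁻¹ * u) x := fun x hx =>
    lift_mul_inv_eq_tau_mul_hinv_mul_of_door N g₁ g₂ u' vfixV (h⁻¹ * u) h u (c.sq 0) hsid hvfix (fun _ _ => rfl) x (hsq x hx)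
  -- (2) the cell bound
  have hcell := norm_uavgZ_one_lift_mul_inv_mul_sub_one_le_at_recordCube_cell N c hk U g₁ g₂ hax₁ hax₂ hN ha₀ hU hcollar a ha hbud hgd haa h100 hguard hθ0 hθ hωτ0
    hωu0 hω hθω hE hjk hy h u hu hh hptu hu1
  -- (3) `hψ`: the record average of the lifted row-9′ field at the cell, through the glue identity and locality
  have hψ : ‖Rbar (zdBlockingZ (F.P K).d (F.P K).L) (bgTZ (F.P K).L (1 : Pt (F.P K).d → Fin (F.P K).d → (MatA N)ˣ)) j (fun x => ((gZ x : (MatA N)ˣ) : MatA N)) y - 1‖ ≤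
      1024 * (4 * (ωτ + ωu)) ^ 2 := by
    rw [rbar_bgTZ_one_apply (L := (F.P K).L) gZ j y, uavgZ_one_congr_at hL j y hglue]
    exact hcell
  -- (4) the τ-side rows, `h`'s block constant, the factors' unitarity
  have hptτ := hpt_lift_at_recordCube_cell N c hk U g₁ g₂ hax₁ hax₂ hN ha₀ hU hcollar a ha hbud hgd haa h100 hguard hθ0 hθ2 hωτ0 hE hjk hy
  have hτu : ∀ x, UnderZ (F.P K).L j y x → τZ x ∈ unitaryUnits (MatA N) :=
    lift_mem_unitaryUnits_under N (fun x' => g₁ x' * (g₂ x')⁻¹) c.k j y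
  have hτrows := osc_rows_of_pointwise_under hL τZ j y hθ0 hθ hωτ0 hωτ128 hτu hptτ
  have hH := (uavgZ_one_unitary_and_near_centre_under hL τZ j y hθ0 hθ hωτ0 hωτ128 hτu hptτ j le_rfl y
    (by rw [Nat.sub_self]; exact (underZ_zero_iff (F.P K).L y y).2 rfl)).1
  have hhinv : ∀ x, UnderZ (F.P K).L j y x → h⁻¹ x = (uavgZ (F.P K).L (1 : Pt (F.P K).d → Fin (F.P K).d → (MatA N)ˣ) τZ j y)⁻¹ := fun x hx => by
    rw [Pi.inv_apply, hh x hx]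
  have hHU1 : (uavgZ (F.P K).L (1 : Pt (F.P K).d → Fin (F.P K).d → (MatA N)ˣ) τZ j y)⁻¹ ∈ U1 (MatA N) := unitaryUnits_le_U1 ((unitaryUnits (MatA N)).inv_mem hH)
  have hau : ∀ x, UnderZ (F.P K).L j y x → (τZ * h⁻¹) x ∈ unitaryUnits (MatA N) := fun x hx => by
    rw [Pi.mul_apply, hhinv x hx]
    exact (unitaryUnits (MatA N)).mul_mem (hτu x hx) ((unitaryUnits (MatA N)).inv_mem hH)
  have hp : ∀ i, i < j → ∀ z, UnderZ (F.P K).L (j - (i + 1)) y z → ∀ x ∈ blockSitesZ (F.P K).L z,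
      ‖(((uavgZ (F.P K).L (1 : Pt (F.P K).d → Fin (F.P K).d → (MatA N)ˣ) (τZ * h⁻¹) i (((F.P K).L : ℤ) • z))⁻¹ : (MatA N)ˣ) : MatA N) *
          ((uavgZ (F.P K).L (1 : Pt (F.P K).d → Fin (F.P K).d → (MatA N)ˣ) (τZ * h⁻¹) i x : (MatA N)ˣ) : MatA N) - 1‖ ≤ 4 * ωτ * θ ^ (j - (i + 1)) := by
    intro i hi z hz x hx
    rw [← Units.val_mul, osc_row_mul_const_eq hL τZ h⁻¹ _ hHU1 j y hhinv hi hz hx, Units.val_mul]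
    exact hτrows i hi z hz x hx
  have hq := osc_rows_of_pointwise_under hL u j y hθ0 hθ hωu0 hωu128 hu hptu
  have hp0 : ∀ i : ℕ, 0 ≤ 4 * ωτ * θ ^ (j - (i + 1)) := fun i => by positivity
  have hq0 : ∀ i : ℕ, 0 ≤ 4 * ωu * θ ^ (j - (i + 1)) := fun i => by positivity
  have hs0 : (0 : ℝ) ≤ 4 * (ωτ + ωu) := by positivity
  have hs128 : 4 * (ωτ + ωu) ≤ 1 / 128 := by linarith
  have hθs : 1024 * θ * (4 * (ωτ + ωu)) ≤ 1 := by linarith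
  have hpq : ∀ i, i < j → 4 * ωτ * θ ^ (j - (i + 1)) + 4 * ωu * θ ^ (j - (i + 1)) ≤ 4 * (ωτ + ωu) * θ ^ (j - (i + 1)) :=
    fun i _ => le_of_eq (by ring)
  have hrows := osc_row_mul_under hL (τZ * h⁻¹) u j y (fun i => 4 * ωτ * θ ^ (j - (i + 1))) (fun i => 4 * ωu * θ ^ (j - (i + 1)))
    hp0 hq0 hθ0 hθ2 hs0 hs128 hθs hpq hau hu hp hq
  -- (5) `hs`: the product's (78) families under the cell are below `δ_N`
  have hs : ∀ i, i < j → ∀ z, UnderZ (F.P K).L (j - (i + 1)) y z → ∀ r : Fin (F.P K).d → Fin (F.P K).L,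
      ‖((((uavgZ (F.P K).L (1 : Pt (F.P K).d → Fin (F.P K).d → (MatA N)ˣ) gZ i (((F.P K).L : ℤ) • z))⁻¹ *
          uavgZ (F.P K).L (1 : Pt (F.P K).d → Fin (F.P K).d → (MatA N)ˣ) gZ i (((F.P K).L : ℤ) • z + offZ (F.P K).L r) : (MatA N)ˣ)) : MatA N) - 1‖ < deltaSU (Fin N) := by
    intro i hi z hz r
    have hloc := uavgZ_one_congr_under hL j y hglue
    have hdepth : j - (i + 1) + 1 = j - i := by omega
    have hc' : UnderZ (F.P K).L (j - i) y (((F.P K).L : ℤ) • z) := by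
      have h' := underZ_add hL hz (underZ_one_centre (F.P K).L z); rwa [hdepth] at h'
    have hx' : UnderZ (F.P K).L (j - i) y (((F.P K).L : ℤ) • z + offZ (F.P K).L r) := by
      have h' := underZ_smul_add_offZ hL hz r; rwa [hdepth] at h'
    rw [Units.val_mul, hloc i hi.le _ hc', hloc i hi.le _ hx']
    exact lt_of_le_of_lt (hrows i hi z hz _ (mem_blockSitesZ.2 ⟨r, rfl⟩)) (hguardN i hi)
  -- (6) FILE 40c: guard release + the φ-row dictionary
  exact norm_coe_gaugeAvgIter_sub_one_le_of_rbar_under N hk (fun x => g₁ x * (u' x)⁻¹) hjk y hs hψ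

end Summit.QuantumFields.YangMills.BalabanUVNodes.N07SymPhiTorusRowAtRecordCubeCell

end
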